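import Mathlib.Analysis.Calculus.Deriv.MeanValue
import Literature.Geometry.Lorentzian.Causality
import Literature.Geometry.Lorentzian.CausalityProofs
import Literature.Geometry.Lorentzian.CausalityRefutedFacts
import HarnessLib

/-!
# The line with two origins as a time-oriented Lorentzian manifold: causal with compact
# diamonds, but not strongly causal

This file records that the (deprecated) named fact
`Literature.Geometry.Lorentzian.LorentzianMetric.IsGloballyHyperbolic.isStronglyCausal` — "a
globally hyperbolic (*causal + compact causal diamonds*) `C²` spacetime is strongly causal",
Bernal–Sánchez 2007, Thm. 3.2; originally declared in `Literature.Geometry.Lorentzian.Causality`,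
see its `## Verdict clean-up` — is **false in the generality in which it is vendored**, and
exhibits the counterexample. The refuting theorems below name the deprecated constants, which
(since 2026-08-15) live verbatim in the leaf module
`Literature.Geometry.Lorentzian.CausalityRefutedFacts`, imported only here and by
`Literature.Geometry.Lorentzian.MinkowskiGlobalHyperbolicity`. The `def` of that fact does
not capture the section's instance hypotheses `[T2Space M] [SecondCountableTopology M]
[BoundarylessManifold I M] [FiniteDimensional ℝ E]` (instance-implicit section variables that are
not used in the body of a `def` are not included in it), so it quantifies over *non-Hausdorff*
manifolds as well, whereas the source proves it for spacetimes (connected *Hausdorff* time-oriented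
Lorentzian manifolds, the standing convention of all of its references). The corrected
(Hausdorff) statement is not vendored (see `## Design notes`).

## The counterexample

* `TwoOriginLine` (`L`): the **line with two origins** (Hirsch 1976, Ch. 1, §1, Exercise 10), the
  points `⟨x, tag⟩` with `x : ℝ` and a Boolean tag that is `true` only for the second origin
  `0₂ = ⟨0, true⟩` (`0₁ = ⟨0, false⟩`). It carries the final topology of the two injections
  `ι b : ℝ → L` (`b : Bool`; `ι b x` is the common point with coordinate `x ≠ 0`, and the origin
  `⟨0, b⟩` for `x = 0`), which are open embeddings with ranges `L ∖ {0_{¬b}}`; the two charts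
  `chart b = (ι b)⁻¹ : L → ℝ`, `p ↦ p.val`, have *all* transition maps equal to the identity of
  `ℝ`, so `L` is a `C^ω` manifold modelled on `𝓘(ℝ, ℝ)` (`instIsManifold`); it is not Hausdorff
  (`not_t2Space`).
* `TwoOriginLine.metric`: the flat Lorentzian metric `g = -dt²` (signature `(−)`), a `C^∞`
  section because the bundle of bilinear forms on `TL` is trivialised by the identity over each
  chart domain (`bilin_trivializationAt_apply`); `TwoOriginLine.timeOrientation`: `T = ∂ₜ`.
* Causality of `L`: a curve `γ : ℝ → L` is manifold-differentiable iff its coordinate `val ∘ γ` is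
  differentiable, with velocity `(val ∘ γ)'` (`hasDerivAt_val_comp`); future-directed causal means
  positive velocity, so `val` increases strictly along future causal curves
  (`strictMonoOn_val_comp`). Hence `L` is causal (`isCausallyWellBehaved`),
  `J⁺(p) = {p} ∪ {t > t(p)}`, `J⁻(q) = {q} ∪ {t < t(q)}` (`mem_causalFuture_iff`,
  `mem_causalPast_iff`, the curves being the chart inverses `ι b` and `s ↦ ι b (-s)`), and every
  causal diamond is a union of two chart images of compact intervals and at most the two origins,
  hence compact (`isCompact_diamond`): `L` is globally hyperbolic in the vendored sense
  (`isGloballyHyperbolic`).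
* Strong causality fails at `0₁` (`not_isStronglyCausal`): `U = range (ι false) = L ∖ {0₂}` is an
  open neighbourhood of `0₁`; any `V ∈ 𝓝 0₁` contains `ι false '' (-ε, ε)`, and the future causal
  curve `ι true` on `[-ε/2, ε/2]` starts and ends in `V` but passes through `ι true 0 = 0₂ ∉ U`.
* `not_isGloballyHyperbolic_isStronglyCausal`: the vendored fact fails at `(L, g, T)` (with
  `n = ∞ ≥ 2`); `LorentzianMetric.IsGloballyHyperbolic.not_forall_isStronglyCausal`: its universal
  closure is false.
* Two neighbouring vendored facts of `Literature.Geometry.Lorentzian.Causality` fail at `(L, g, T)`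
  as well: `IsGloballyHyperbolic.isClosed_causalFuture` ("`J⁺(p)` is closed in a globally
  hyperbolic spacetime", O'Neill 1983, Lemma 14.22 — same missing Hausdorff hypothesis: `0₂` lies
  in the closure of `J⁺(0₁) = {0₁} ∪ {t > 0}`, `not_isClosed_causalFuture_origin`,
  `not_isGloballyHyperbolic_isClosed_causalFuture`), and Geroch's
  `isGloballyHyperbolic_iff_exists_isCauchySurface` (here the defect is the vendored
  `IsCauchySurface`, uninhabited on nonempty manifolds by
  `Literature.Geometry.Lorentzian.CausalityProofs`; `L` supplies a globally hyperbolic instance,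
  `not_isGloballyHyperbolic_iff_exists_isCauchySurface`).

## Design notes

* The identification `TangentSpace 𝓘(ℝ, ℝ) p = ℝ` is used throughout, under
  `set_option backward.isDefEq.respectTransparency false` as in Mathlib's
  `Mathlib.Geometry.Manifold.Riemannian.Basic`; statements mixing the two sides are phrased with
  real variables (`isFutureDirected_iff`).
* Mathlib has no line with two origins (`lean search 'two origins'` is empty) and no Lorentzian
  causality; nothing here duplicates a Mathlib instance (all instances are on the new type).
* Deliberately not here: the (true) Hausdorff statement, Bernal–Sánchez 2007, Thm. 3.2, whose proof
  goes through causal simplicity and the causal ladder (limit-curve theorems); it is not vendored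
  in the tree (no in-tree user; `Literature.Geometry.Lorentzian.Causality`, `## Verdict clean-up`).

## References

* M. W. Hirsch, *Differential Topology*, GTM 33, Springer 1976, Ch. 1, §1, Exercise 10 (the line
  with two origins, a non-Hausdorff `C^ω` 1-manifold).
* A. N. Bernal, M. Sánchez, *Globally hyperbolic spacetimes can be defined as "causal" instead of
  "strongly causal"*, Class. Quantum Grav. 24 (2007) 745–749, Thm. 3.2.
* B. O'Neill, *Semi-Riemannian geometry with applications to relativity*, Academic Press 1983,
  Ch. 14, pp. 402–403 (`J±`), p. 437 (strong causality).
-/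

noncomputable section

open Bundle Set Filter Function
open scoped Manifold ContDiff Topology

namespace Literature.Geometry.Lorentzian

-- The identification `TangentSpace 𝓘(ℝ, ℝ) p = ℝ` is used throughout (as in Mathlib's
-- `Mathlib.Geometry.Manifold.Riemannian.Basic`).
set_option backward.isDefEq.respectTransparency false

/-- The **line with two origins** `L`: a point is a real coordinate `val` together with a Boolean
`tag` which is `true` only for the second origin `0₂ = ⟨0, true⟩`; all points with `val ≠ 0` carry
the tag `false`, and `0₁ = ⟨0, false⟩`. This is (a concrete model of) the quotient of
`ℝ × {0, 1}` identifying `(x, 1)` with `(x, 0)` for `x ≠ 0`. Hirsch 1976, Ch. 1, §1, Exercise 10.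
[cite: HirschDT1976, Ch. 1, §1, Exercise 10] -/
@[ext]
structure TwoOriginLine : Type where
  /-- The real coordinate of the point (the common value of both charts). -/
  val : ℝ
  /-- The tag distinguishing the second origin. -/
  tag : Bool
  /-- Only the origin is doubled. -/
  tag_eq : val ≠ 0 → tag = false

namespace TwoOriginLine

/-- The two chart inverses `ι b : ℝ → L` (`b : Bool`): `ι b x` is the point with coordinate `x`,
namely the common point `⟨x, false⟩` for `x ≠ 0` and the origin `⟨0, b⟩` for `x = 0` (the two
sheets `ℝ × {b}` of Hirsch's quotient). [cite: HirschDT1976, Ch. 1, §1, Exercise 10] -/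
def ι (b : Bool) (x : ℝ) : TwoOriginLine :=
  ⟨x, b && decide (x = 0), fun hx ↦ by simp [hx]⟩

/-- The coordinate of `ι b x` is `x`. [folklore] -/
@[simp] lemma ι_val (b : Bool) (x : ℝ) : (ι b x).val = x := rfl

/-- The tag of `ι b x` is `b` at `x = 0` and `false` otherwise. [folklore] -/
lemma ι_tag (b : Bool) (x : ℝ) : (ι b x).tag = (b && decide (x = 0)) := rfl

/-- `ι b 0` is the origin with tag `b`. [folklore] -/
@[simp] lemma ι_zero_tag (b : Bool) : (ι b 0).tag = b := by simp [ι_tag]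

/-- Each `ι b` is injective. [folklore] -/
lemma ι_injective (b : Bool) : Injective (ι b) := fun x y h ↦ by
  simpa using congrArg val h

/-- Off the origin the two sheets are identified: `ι b x = ι c x` for `x ≠ 0`.
[cite: HirschDT1976, Ch. 1, §1, Exercise 10] -/
lemma ι_eq_ι_of_ne_zero {x : ℝ} (hx : x ≠ 0) (b c : Bool) : ι b x = ι c x := by
  ext <;> simp [ι_tag, hx]

/-- Every point lies on the sheet of its own tag: `ι p.tag p.val = p`. [folklore] -/
@[simp] lemma ι_tag_val (p : TwoOriginLine) : ι p.tag p.val = p := by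
  ext
  · rfl
  · by_cases h : p.val = 0
    · simp [ι_tag, h]
    · simp [ι_tag, h, p.tag_eq h]

/-- A point with nonzero coordinate lies on both sheets. [folklore] -/
lemma eq_ι_of_val_ne_zero (p : TwoOriginLine) (hp : p.val ≠ 0) (b : Bool) : p = ι b p.val := by
  rw [← ι_eq_ι_of_ne_zero hp p.tag b, ι_tag_val]

/-- `ι b x = ι c y` iff `x = y` and the tags agree in case `x = 0`. [folklore] -/
lemma ι_eq_ι_iff {b c : Bool} {x y : ℝ} : ι b x = ι c y ↔ x = y ∧ (x = 0 → b = c) := by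
  constructor
  · intro h
    have hxy : x = y := by simpa using congrArg val h
    subst hxy
    refine ⟨rfl, fun hx ↦ ?_⟩
    simpa [ι_tag, hx] using congrArg tag h
  · rintro ⟨rfl, h⟩
    by_cases hx : x = 0
    · subst hx; rw [h rfl]
    · exact ι_eq_ι_of_ne_zero hx b c

/-! ### Topology: the final topology of the two maps `ι b` -/

/-- The topology of `L`: the final (quotient) topology for the two maps `ι b : ℝ → L`, i.e.
`U` is open iff both `(ι b)⁻¹(U)` are open. [cite: HirschDT1976, Ch. 1, §1, Exercise 10] -/
instance instTopologicalSpace : TopologicalSpace TwoOriginLine :=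
  ⨆ b : Bool, TopologicalSpace.coinduced (ι b) inferInstance

/-- A set is open in `L` iff its preimages under both `ι b` are open. [folklore] -/
lemma isOpen_iff {U : Set TwoOriginLine} : IsOpen U ↔ ∀ b, IsOpen (ι b ⁻¹' U) := by
  rw [isOpen_iSup_iff]
  exact forall_congr' fun b ↦ isOpen_coinduced

/-- The maps `ι b` are continuous. [folklore] -/
lemma continuous_ι (b : Bool) : Continuous (ι b) :=
  continuous_iSup_rng (i := b) continuous_coinduced_rng

/-- The coordinate `val : L → ℝ` is continuous. [folklore] -/
lemma continuous_val : Continuous (val : TwoOriginLine → ℝ) := by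
  rw [continuous_def]
  intro V hV
  rw [isOpen_iff]
  intro b
  exact hV

/-- `(ι c)⁻¹(ι b '' V) = V` minus the origin if `b ≠ c`. [folklore] -/
lemma preimage_ι_image_ι (b c : Bool) (V : Set ℝ) :
    ι c ⁻¹' (ι b '' V) = V ∩ {x | x = 0 → b = c} := by
  ext x
  simp only [mem_preimage, mem_image, mem_inter_iff, mem_setOf_eq]
  constructor
  · rintro ⟨y, hy, h⟩
    obtain ⟨rfl, h'⟩ := ι_eq_ι_iff.mp h
    exact ⟨hy, h'⟩
  · rintro ⟨hx, h⟩
    exact ⟨x, hx, ι_eq_ι_iff.mpr ⟨rfl, h⟩⟩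

/-- The maps `ι b` are open. [folklore] -/
lemma isOpenMap_ι (b : Bool) : IsOpenMap (ι b) := by
  intro V hV
  rw [isOpen_iff]
  intro c
  rw [preimage_ι_image_ι]
  by_cases hbc : b = c
  · simpa [hbc] using hV
  · have : {x : ℝ | x = 0 → b = c} = {0}ᶜ := by
      ext x; simp [hbc]
    rw [this]
    exact hV.inter isOpen_compl_singleton

/-- The maps `ι b` are open embeddings (so `L` is locally Euclidean of dimension `1`).
[cite: HirschDT1976, Ch. 1, §1, Exercise 10] -/
lemma isOpenEmbedding_ι (b : Bool) : Topology.IsOpenEmbedding (ι b) :=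
  .of_continuous_injective_isOpenMap (continuous_ι b) (ι_injective b) (isOpenMap_ι b)

/-- The range of `ι b` is `L` minus the other origin. [folklore] -/
lemma range_ι (b : Bool) : range (ι b) = {p | p.val = 0 → p.tag = b} := by
  ext p
  constructor
  · rintro ⟨x, rfl⟩ (hx : x = 0)
    simp [ι_tag, hx]
  · intro hp
    by_cases h : p.val = 0
    · exact ⟨p.val, by rw [← hp h, ι_tag_val]⟩
    · exact ⟨p.val, (eq_ι_of_val_ne_zero p h b).symm⟩

/-- `L` minus an origin is open. [folklore] -/
lemma isOpen_setOf_tag (b : Bool) : IsOpen {p : TwoOriginLine | p.val = 0 → p.tag = b} := by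
  rw [← range_ι]
  exact (isOpenMap_ι b).isOpen_range

/-- Neighbourhoods of an origin contain punctured intervals of *both* sheets: if `U ∈ 𝓝 (ι b 0)`
then `ι c x ∈ U` for all `x ≠ 0` near `0` and every `c`. [folklore] -/
lemma eventually_ι_mem_of_mem_nhds {b : Bool} {U : Set TwoOriginLine} (hU : U ∈ 𝓝 (ι b 0))
    (c : Bool) : ∀ᶠ x in 𝓝[≠] (0 : ℝ), ι c x ∈ U := by
  have h : ι b ⁻¹' U ∈ 𝓝 (0 : ℝ) := (continuous_ι b).continuousAt.preimage_mem_nhds hU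
  have h' : ∀ᶠ x in 𝓝[≠] (0 : ℝ), x ≠ 0 := self_mem_nhdsWithin
  filter_upwards [nhdsWithin_le_nhds h, h'] with x hx hx0
  rwa [ι_eq_ι_of_ne_zero hx0 c b]

/-- **The line with two origins is not Hausdorff**: every neighbourhood of `0₁` meets every
neighbourhood of `0₂`. Hirsch 1976, Ch. 1, §1, Exercise 10 ("a nonHausdorff 1-manifold").
[cite: HirschDT1976, Ch. 1, §1, Exercise 10] -/
theorem not_t2Space : ¬ T2Space TwoOriginLine := by
  intro hT
  obtain ⟨U, V, hU, hV, hU1, hV2, hUV⟩ :=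
    t2_separation (show ι false 0 ≠ ι true 0 from fun h ↦ by simpa using congrArg tag h)
  have h1 := eventually_ι_mem_of_mem_nhds (hU.mem_nhds hU1) false
  have h2 := eventually_ι_mem_of_mem_nhds (hV.mem_nhds hV2) false
  obtain ⟨x, hxU, hxV⟩ := (h1.and h2).exists
  exact disjoint_left.mp hUV hxU hxV

/-! ### The two charts and the manifold structure -/

/-- The chart `chart b : L → ℝ`, `p ↦ p.val`, with source `L ∖ {0_{¬b}}`, target `ℝ` and inverse
`ι b`. [cite: HirschDT1976, Ch. 1, §1, Exercise 10] -/
def chart (b : Bool) : OpenPartialHomeomorph TwoOriginLine ℝ where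
  toFun := val
  invFun := ι b
  source := {p | p.val = 0 → p.tag = b}
  target := univ
  map_source' _ _ := mem_univ _
  map_target' x _ := by
    intro (hx : x = 0)
    simp [ι_tag, hx]
  left_inv' p hp := by
    show ι b p.val = p
    by_cases h : p.val = 0
    · rw [← hp h, ι_tag_val]
    · exact (eq_ι_of_val_ne_zero p h b).symm
  right_inv' _ _ := rfl
  open_source := isOpen_setOf_tag b
  open_target := isOpen_univ
  continuousOn_toFun := continuous_val.continuousOn
  continuousOn_invFun := (continuous_ι b).continuousOn

/-- Both charts are the coordinate `val` (as total functions). [folklore] -/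
@[simp] lemma chart_apply (b : Bool) (p : TwoOriginLine) : chart b p = p.val := rfl

/-- The inverse of `chart b` is `ι b`. [folklore] -/
@[simp] lemma chart_symm_apply (b : Bool) (x : ℝ) : (chart b).symm x = ι b x := rfl

/-- The source of `chart b` is `L` minus the other origin. [folklore] -/
lemma chart_source (b : Bool) : (chart b).source = {p | p.val = 0 → p.tag = b} := rfl

/-- The target of `chart b` is all of `ℝ`. [folklore] -/
@[simp] lemma chart_target (b : Bool) : (chart b).target = univ := rfl

/-- Membership in the source of `chart b`. [folklore] -/
lemma mem_chart_source_iff {b : Bool} {p : TwoOriginLine} :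
    p ∈ (chart b).source ↔ (p.val = 0 → p.tag = b) := Iff.rfl

/-- The atlas `{chart false, chart true}` of `L`, the preferred chart at `p` being the one of its
own sheet. [cite: HirschDT1976, Ch. 1, §1, Exercise 10] -/
instance instChartedSpace : ChartedSpace ℝ TwoOriginLine where
  atlas := range chart
  chartAt p := chart p.tag
  mem_chart_source _ := fun _ ↦ rfl
  chart_mem_atlas _ := mem_range_self _

/-- The preferred chart at `p` is `chart p.tag`. [folklore] -/
@[simp] lemma chartAt_eq (p : TwoOriginLine) : chartAt ℝ p = chart p.tag := rfl

/-- The atlas of `L` consists of the two charts `chart b`. [folklore] -/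
lemma mem_atlas_iff {e : OpenPartialHomeomorph TwoOriginLine ℝ} :
    e ∈ atlas ℝ TwoOriginLine ↔ ∃ b, chart b = e := Iff.rfl

/-- All (extended) transition maps of `L` are globally the identity of `ℝ`. [folklore] -/
lemma extend_comp_extend_symm (b c : Bool) :
    (chart c).extend 𝓘(ℝ, ℝ) ∘ ((chart b).extend 𝓘(ℝ, ℝ)).symm = id := by
  funext x
  rfl

/-- **`L` is a `C^ω` (hence `C^∞`, `C¹`, …) manifold modelled on `ℝ`**: its transition maps are
the identity. Hirsch 1976, Ch. 1, §1, Exercise 10 ("It has a `C^ω` differential structure").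
[cite: HirschDT1976, Ch. 1, §1, Exercise 10] -/
instance instIsManifold : IsManifold 𝓘(ℝ, ℝ) ω TwoOriginLine :=
  isManifold_of_contDiffOn _ _ _ fun e e' he he' ↦ by
    obtain ⟨b, rfl⟩ := he
    obtain ⟨c, rfl⟩ := he'
    have : (𝓘(ℝ, ℝ) ∘ ((chart b).symm ≫ₕ chart c) ∘ 𝓘(ℝ, ℝ).symm) = id := by
      funext x
      rfl
    rw [this]
    exact contDiffOn_id

/-! ### The tangent bundle of `L` and the bundles of (bi)linear forms are trivialised by the
identity -/

/-- All coordinate changes of the tangent bundle core of `L` are the identity (the transition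
maps being the identity of `ℝ`). [folklore] -/
theorem tangentBundleCore_coordChange_eq (i j : atlas ℝ TwoOriginLine) (p : TwoOriginLine) :
    (tangentBundleCore 𝓘(ℝ, ℝ) TwoOriginLine).coordChange i j p = ContinuousLinearMap.id ℝ ℝ := by
  obtain ⟨_, b, rfl⟩ := i
  obtain ⟨_, c, rfl⟩ := j
  rw [tangentBundleCore_coordChange]
  dsimp only
  rw [extend_comp_extend_symm, ModelWithCorners.range_eq_univ, fderivWithin_univ, fderiv_id]

/-- The preferred trivialisation of `TL` at `p₀` is `⟨p, v⟩ ↦ (p, v)` on all of `TL`.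
[folklore] -/
theorem trivializationAt_tangent_apply (p₀ : TwoOriginLine)
    (z : TangentBundle 𝓘(ℝ, ℝ) TwoOriginLine) :
    trivializationAt ℝ (TangentSpace 𝓘(ℝ, ℝ)) p₀ z = (z.proj, z.2) := by
  rw [TangentBundle.trivializationAt_eq_localTriv]
  show (z.proj, (tangentBundleCore 𝓘(ℝ, ℝ) TwoOriginLine).coordChange _ _ _ z.2) = _
  rw [tangentBundleCore_coordChange_eq]
  rfl

/-- The continuous-linear inverse trivialisation of `TL` is the identity on fibres over the chart
domain. [folklore] -/
theorem symmL_trivializationAt_apply {p₀ p : TwoOriginLine} (hp : p ∈ (chart p₀.tag).source)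
    (v : ℝ) : (trivializationAt ℝ (TangentSpace 𝓘(ℝ, ℝ)) p₀).symmL ℝ p v = v := by
  rw [TangentBundle.symmL_trivializationAt_eq_core hp, tangentBundleCore_coordChange_eq]
  rfl

/-- The continuous-linear trivialisation of `TL` is the identity on fibres over the chart
domain. [folklore] -/
theorem continuousLinearMapAt_trivializationAt_apply {p₀ p : TwoOriginLine}
    (hp : p ∈ (chart p₀.tag).source) (v : TangentSpace 𝓘(ℝ, ℝ) p) :
    (trivializationAt ℝ (TangentSpace 𝓘(ℝ, ℝ)) p₀).continuousLinearMapAt ℝ p v = v := by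
  rw [TangentBundle.continuousLinearMapAt_trivializationAt_eq_core hp,
    tangentBundleCore_coordChange_eq]
  rfl

/-- The preferred trivialisation of the bundle of covectors `p ↦ (T_p L →L[ℝ] ℝ)` is the identity
on fibres over the chart domain. [folklore] -/
theorem dual_continuousLinearMapAt_apply {p₀ p : TwoOriginLine} (hp : p ∈ (chart p₀.tag).source)
    (φ : TangentSpace 𝓘(ℝ, ℝ) p →L[ℝ] ℝ) (u : ℝ) :
    (trivializationAt (ℝ →L[ℝ] ℝ) (fun q : TwoOriginLine ↦ TangentSpace 𝓘(ℝ, ℝ) q →L[ℝ] ℝ)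
      p₀).continuousLinearMapAt ℝ p φ u = φ u := by
  have h := Trivialization.continuousLinearMapAt_apply_of_mem (R := ℝ)
    (trivializationAt (ℝ →L[ℝ] ℝ) (fun q : TwoOriginLine ↦ TangentSpace 𝓘(ℝ, ℝ) q →L[ℝ] ℝ) p₀)
    (b := p) (by simpa using hp) φ
  rw [hom_trivializationAt_apply] at h
  have h2 : ContinuousLinearMap.inCoordinates ℝ (TangentSpace 𝓘(ℝ, ℝ)) ℝ
      (Bundle.Trivial TwoOriginLine ℝ) p₀ p p₀ p φ u = φ u := by
    simp only [ContinuousLinearMap.inCoordinates, ContinuousLinearMap.coe_comp,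
      Function.comp_apply, Bundle.Trivial.fiberBundle_trivializationAt',
      Bundle.Trivial.continuousLinearMapAt_trivialization, ContinuousLinearMap.coe_id', id_eq]
    rw [symmL_trivializationAt_apply hp]
  exact (DFunLike.congr_fun h u).trans h2

/-- The preferred trivialisation of the bundle of bilinear forms `p ↦ (T_p L →L T_p L →L ℝ)`
(in which metrics are sections) is the identity on fibres over the chart domain. [folklore] -/
theorem bilin_trivializationAt_apply {p₀ p : TwoOriginLine} (hp : p ∈ (chart p₀.tag).source)
    (B : TangentSpace 𝓘(ℝ, ℝ) p →L[ℝ] TangentSpace 𝓘(ℝ, ℝ) p →L[ℝ] ℝ) (v w : ℝ) :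
    (trivializationAt (ℝ →L[ℝ] ℝ →L[ℝ] ℝ)
      (fun q : TwoOriginLine ↦ TangentSpace 𝓘(ℝ, ℝ) q →L[ℝ] TangentSpace 𝓘(ℝ, ℝ) q →L[ℝ] ℝ) p₀
        ⟨p, B⟩).2 v w = B v w := by
  rw [hom_trivializationAt_apply]
  simp only [ContinuousLinearMap.inCoordinates, ContinuousLinearMap.coe_comp,
    Function.comp_apply]
  rw [symmL_trivializationAt_apply hp, dual_continuousLinearMapAt_apply hp]

/-! ### The Lorentzian metric `-dt²` and the time orientation `∂ₜ` -/

/-- The bilinear form `(v, w) ↦ -(v w)` on `ℝ` (the metric `-dt²` in a chart). [folklore] -/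
def negMul : ℝ →L[ℝ] ℝ →L[ℝ] ℝ := -ContinuousLinearMap.mul ℝ ℝ

/-- `negMul v w = -(v w)`. [folklore] -/
@[simp] lemma negMul_apply (v w : ℝ) : negMul v w = -(v * w) := rfl

/-- `negMul` is symmetric. [folklore] -/
lemma negMul_comm (v w : ℝ) : negMul v w = negMul w v := by
  simp [mul_comm]

/-- `negMul` is nondegenerate. [folklore] -/
lemma negMul_nondegenerate (v : ℝ) (hv : ∀ w : ℝ, negMul v w = 0) : v = 0 := by
  simpa using hv 1

/-- `1` is a timelike vector for `negMul`. [folklore] -/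
lemma negMul_one_one : negMul 1 1 < 0 := by simp

/-- The Lorentzian signature condition for `negMul` (vacuous in dimension `1`: the orthogonal
complement of a timelike vector is `0`). [folklore] -/
lemma negMul_pos_of_orthogonal (v w : ℝ) (hv : negMul v v < 0) (hvw : negMul v w = 0)
    (hw : w ≠ 0) : 0 < negMul w w := by
  simp only [negMul_apply, neg_eq_zero, mul_eq_zero] at hvw
  rcases hvw with h | h
  · simp [h] at hv
  · exact absurd h hw

/-- **The flat Lorentzian metric `g = -dt²` on the line with two origins** (in both charts), a
`C^∞` Lorentzian metric of signature `(−)`: it is a `C^∞` section of the bundle of bilinear forms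
because that bundle is trivialised by the identity over each chart domain, where the section is
constant. [folklore] -/
def metric : LorentzianMetric 𝓘(ℝ, ℝ) ∞ TwoOriginLine where
  val _ := negMul
  symm _ v w := negMul_comm v w
  nondegenerate _ v hv := negMul_nondegenerate v hv
  contMDiff := by
    intro p₀
    rw [contMDiffAt_section]
    apply (contMDiffAt_const (c := negMul)).congr_of_eventuallyEq
    filter_upwards [(chart p₀.tag).open_source.mem_nhds (mem_chart_source ℝ p₀)] with p hp
    refine ContinuousLinearMap.ext fun v ↦ ContinuousLinearMap.ext fun w ↦ ?_
    exact bilin_trivializationAt_apply hp _ v w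
  exists_timelike _ := ⟨(1 : ℝ), negMul_one_one⟩
  pos_of_orthogonal _ v w hv hvw hw := negMul_pos_of_orthogonal v w hv hvw hw

/-- The metric is `g_p(v, w) = -(v w)` at every point. [folklore] -/
@[simp] lemma metric_val (p : TwoOriginLine) (v w : ℝ) : metric.val p v w = -(v * w) := rfl

/-- **The time orientation `T = ∂ₜ`** of `(L, -dt²)`: the constant vector field `1` in both
charts (a `C^∞` section since `TL` is trivialised by the identity). [folklore] -/
def timeOrientation : TimeOrientation metric where
  vectorField _ := (1 : ℝ)
  isTimelike _ := by simp [LorentzianMetric.IsTimelike]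
  contMDiff := by
    intro p₀
    rw [contMDiffAt_section]
    apply (contMDiffAt_const (c := (1 : ℝ))).congr_of_eventuallyEq
    filter_upwards [] with p
    exact congrArg Prod.snd (trivializationAt_tangent_apply p₀ ⟨p, (1 : ℝ)⟩)

/-- The orienting vector field is `1` at every point. [folklore] -/
@[simp] lemma timeOrientation_vectorField (p : TwoOriginLine) :
    timeOrientation.vectorField p = (1 : ℝ) := rfl

/-- A tangent vector `v ∈ T_p L = ℝ` is future-directed causal iff `v > 0`. [folklore] -/
lemma isFutureDirected_iff {p : TwoOriginLine} {v : ℝ} :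
    timeOrientation.IsFutureDirected (x := p) v ↔ 0 < v := by
  change ((-(v * v) ≤ 0 ∧ v ≠ 0) ∧ -(1 * v) < 0) ↔ 0 < v
  constructor
  · rintro ⟨-, h⟩
    linarith
  · intro h
    exact ⟨⟨by nlinarith, h.ne'⟩, by linarith⟩

/-- A tangent vector `v ∈ T_p L = ℝ` is future-directed causal for the *reversed* time
orientation iff `v < 0`. [folklore] -/
lemma isFutureDirected_reverse_iff {p : TwoOriginLine} {v : ℝ} :
    timeOrientation.reverse.IsFutureDirected (x := p) v ↔ v < 0 := by
  change ((-(v * v) ≤ 0 ∧ v ≠ 0) ∧ -(-(1 : ℝ) * v) < 0) ↔ v < 0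
  constructor
  · rintro ⟨-, h⟩
    linarith
  · intro h
    exact ⟨⟨by nlinarith, h.ne⟩, by linarith⟩

/-! ### Curves in `L`: manifold derivatives are derivatives of the coordinate `val` -/

/-- In the charts of `L` a curve `f : ℝ → L` reads `val ∘ f`. [folklore] -/
lemma writtenInExtChartAt_eq (f : ℝ → TwoOriginLine) (s : ℝ) :
    writtenInExtChartAt 𝓘(ℝ, ℝ) 𝓘(ℝ, ℝ) s f = val ∘ f := by
  funext y
  rfl

/-- A curve in `L` is manifold-differentiable at `s` iff it is continuous at `s` and its coordinate
is differentiable at `s`. [folklore] -/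
lemma mdifferentiableAt_iff_differentiableAt {f : ℝ → TwoOriginLine} {s : ℝ} :
    MDifferentiableAt 𝓘(ℝ, ℝ) 𝓘(ℝ, ℝ) f s ↔
      ContinuousAt f s ∧ DifferentiableAt ℝ (val ∘ f) s := by
  rw [mdifferentiableAt_iff, writtenInExtChartAt_eq, ModelWithCorners.range_eq_univ,
    differentiableWithinAt_univ]
  rfl

/-- The velocity of a differentiable curve in `L` is the derivative of its coordinate.
[folklore] -/
lemma velocity_eq_deriv {f : ℝ → TwoOriginLine} {s : ℝ}
    (hf : MDifferentiableAt 𝓘(ℝ, ℝ) 𝓘(ℝ, ℝ) f s) :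
    velocity 𝓘(ℝ, ℝ) f s = deriv (val ∘ f) s := by
  simp only [velocity, hf.mfderiv, writtenInExtChartAt_eq, ModelWithCorners.range_eq_univ,
    fderivWithin_univ]
  rfl

/-- The coordinate of a differentiable curve in `L` has the velocity as its derivative.
[folklore] -/
lemma hasDerivAt_val_comp {f : ℝ → TwoOriginLine} {s : ℝ}
    (hf : MDifferentiableAt 𝓘(ℝ, ℝ) 𝓘(ℝ, ℝ) f s) :
    HasDerivAt (val ∘ f) (velocity 𝓘(ℝ, ℝ) f s) s := by
  rw [velocity_eq_deriv hf]
  exact (mdifferentiableAt_iff_differentiableAt.mp hf).2.hasDerivAt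

/-- A reparametrised sheet `ι b ∘ φ` is manifold-differentiable where `φ` is differentiable.
[folklore] -/
lemma mdifferentiableAt_ι_comp {φ : ℝ → ℝ} {s : ℝ} (hφ : DifferentiableAt ℝ φ s) (b : Bool) :
    MDifferentiableAt 𝓘(ℝ, ℝ) 𝓘(ℝ, ℝ) (ι b ∘ φ) s :=
  mdifferentiableAt_iff_differentiableAt.mpr
    ⟨(continuous_ι b).continuousAt.comp hφ.continuousAt, hφ⟩

/-- The velocity of `ι b ∘ φ` is `φ'`. [folklore] -/
lemma velocity_ι_comp {φ : ℝ → ℝ} {s : ℝ} (hφ : DifferentiableAt ℝ φ s) (b : Bool) :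
    velocity 𝓘(ℝ, ℝ) (ι b ∘ φ) s = deriv φ s := by
  rw [velocity_eq_deriv (mdifferentiableAt_ι_comp hφ b)]
  rfl

/-- `ι b` is a future causal curve (velocity `∂ₜ`) on every parameter set. O'Neill 1983, Ch. 14,
p. 402 (causal curves). [folklore] -/
lemma isFutureCausalCurveOn_ι (b : Bool) (S : Set ℝ) :
    metric.IsFutureCausalCurveOn timeOrientation (ι b) S := fun s _ ↦ by
  refine ⟨mdifferentiableAt_ι_comp differentiableAt_id b, ?_⟩
  rw [isFutureDirected_iff, show ι b = ι b ∘ id from rfl, velocity_ι_comp differentiableAt_id b,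
    deriv_id]
  exact one_pos

/-- `s ↦ ι b (-s)` is a future causal curve for the reversed time orientation (velocity `-∂ₜ`),
i.e. a past-directed causal curve. [folklore] -/
lemma isFutureCausalCurveOn_ι_comp_neg (b : Bool) (S : Set ℝ) :
    metric.IsFutureCausalCurveOn timeOrientation.reverse (ι b ∘ Neg.neg) S := fun s _ ↦ by
  refine ⟨mdifferentiableAt_ι_comp differentiable_neg.differentiableAt b, ?_⟩
  rw [isFutureDirected_reverse_iff, velocity_ι_comp differentiable_neg.differentiableAt b,
    deriv_neg]
  exact neg_one_lt_zero

/-- **Along a future causal curve the coordinate `val` is strictly increasing** (its derivative,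
the velocity, is positive). [folklore] -/
lemma strictMonoOn_val_comp {γ : ℝ → TwoOriginLine} {S : Set ℝ} (hS : Convex ℝ S)
    (hγ : metric.IsFutureCausalCurveOn timeOrientation γ S) : StrictMonoOn (val ∘ γ) S :=
  strictMonoOn_of_deriv_pos hS
    (fun s hs ↦ (hasDerivAt_val_comp (hγ s hs).1).continuousAt.continuousWithinAt)
    fun s hs ↦ by
      have hs' : s ∈ S := interior_subset hs
      rw [(hasDerivAt_val_comp (hγ s hs').1).deriv]
      exact isFutureDirected_iff.mp (hγ s hs').2

/-- Along a future causal curve for the reversed orientation `val` is strictly decreasing.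
[folklore] -/
lemma strictAntiOn_val_comp {γ : ℝ → TwoOriginLine} {S : Set ℝ} (hS : Convex ℝ S)
    (hγ : metric.IsFutureCausalCurveOn timeOrientation.reverse γ S) :
    StrictAntiOn (val ∘ γ) S :=
  strictAntiOn_of_deriv_neg hS
    (fun s hs ↦ (hasDerivAt_val_comp (hγ s hs).1).continuousAt.continuousWithinAt)
    fun s hs ↦ by
      have hs' : s ∈ S := interior_subset hs
      rw [(hasDerivAt_val_comp (hγ s hs').1).deriv]
      exact isFutureDirected_reverse_iff.mp (hγ s hs').2

/-- The endpoint of a future causal curve segment has larger coordinate than its initial point.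
[folklore] -/
lemma val_lt_val {γ : ℝ → TwoOriginLine} {a c : ℝ} (hac : a < c)
    (hγ : metric.IsFutureCausalCurveOn timeOrientation γ (Icc a c)) : (γ a).val < (γ c).val :=
  strictMonoOn_val_comp (convex_Icc a c) hγ (left_mem_Icc.mpr hac.le) (right_mem_Icc.mpr hac.le)
    hac

/-! ### Causal futures, pasts and diamonds of `L` -/

/-- **`J⁺(p) = {p} ∪ {r | t(p) < t(r)}`** in `L` (the curves being the sheets `ι b`).
[folklore] -/
theorem mem_causalFuture_iff {p r : TwoOriginLine} :
    r ∈ metric.causalFuture timeOrientation {p} ↔ r = p ∨ p.val < r.val := by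
  rw [LorentzianMetric.mem_causalFuture_iff]
  simp only [mem_singleton_iff, exists_eq_left]
  constructor
  · rintro (h | ⟨γ, a, c, hac, hγ, rfl, rfl⟩)
    · exact Or.inl h
    · exact Or.inr (val_lt_val hac hγ)
  · rintro (h | h)
    · exact Or.inl h
    · refine Or.inr ?_
      by_cases hp : p.val = 0
      · exact ⟨ι p.tag, p.val, r.val, h, isFutureCausalCurveOn_ι _ _, ι_tag_val p,
          (eq_ι_of_val_ne_zero r (by linarith) p.tag).symm⟩
      · exact ⟨ι r.tag, p.val, r.val, h, isFutureCausalCurveOn_ι _ _,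
          (eq_ι_of_val_ne_zero p hp r.tag).symm, ι_tag_val r⟩

/-- **`J⁻(q) = {q} ∪ {r | t(r) < t(q)}`** in `L` (the curves being `s ↦ ι b (-s)`).
[folklore] -/
theorem mem_causalPast_iff {q r : TwoOriginLine} :
    r ∈ metric.causalPast timeOrientation {q} ↔ r = q ∨ r.val < q.val := by
  rw [LorentzianMetric.causalPast, LorentzianMetric.mem_causalFuture_iff]
  simp only [mem_singleton_iff, exists_eq_left]
  constructor
  · rintro (h | ⟨γ, a, c, hac, hγ, rfl, rfl⟩)
    · exact Or.inl h
    · exact Or.inr (strictAntiOn_val_comp (convex_Icc a c) hγ (left_mem_Icc.mpr hac.le)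
        (right_mem_Icc.mpr hac.le) hac)
  · rintro (h | h)
    · exact Or.inl h
    · refine Or.inr ?_
      by_cases hq : q.val = 0
      · refine ⟨ι q.tag ∘ Neg.neg, -q.val, -r.val, by linarith,
          isFutureCausalCurveOn_ι_comp_neg _ _, ?_, ?_⟩
        · show ι q.tag (-(-q.val)) = q
          rw [neg_neg, ι_tag_val]
        · show ι q.tag (-(-r.val)) = r
          rw [neg_neg]
          exact (eq_ι_of_val_ne_zero r (by linarith) q.tag).symm
      · refine ⟨ι r.tag ∘ Neg.neg, -q.val, -r.val, by linarith,
          isFutureCausalCurveOn_ι_comp_neg _ _, ?_, ?_⟩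
        · show ι r.tag (-(-q.val)) = q
          rw [neg_neg]
          exact (eq_ι_of_val_ne_zero q hq r.tag).symm
        · show ι r.tag (-(-r.val)) = r
          rw [neg_neg, ι_tag_val]

/-- Membership in a causal diamond `J⁺(p) ∩ J⁻(q)` of `L`. [folklore] -/
lemma mem_diamond_iff {p q r : TwoOriginLine} :
    r ∈ metric.causalFuture timeOrientation {p} ∩ metric.causalPast timeOrientation {q} ↔
      (r = p ∨ p.val < r.val) ∧ (r = q ∨ r.val < q.val) := by
  rw [mem_inter_iff, mem_causalFuture_iff, mem_causalPast_iff]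

/-- `L` has finitely many (namely two) points over `0`. [folklore] -/
lemma finite_setOf_val_eq_zero : {o : TwoOriginLine | o.val = 0}.Finite := by
  refine ((Set.finite_singleton (ι true 0)).insert (ι false 0)).subset ?_
  intro o ho
  have ho : o.val = 0 := ho
  rw [← ι_tag_val o, ho]
  cases o.tag <;> simp

/-- **The causal diamonds of `L` are compact**: for `t(p) < t(q)` the diamond `J⁺(p) ∩ J⁻(q)` is
the union of the images of `[t(p), m]` and `[m, t(q)]` (`m` the midpoint) under the sheets through
`p` and `q` and of at most the two origins; otherwise it is contained in `{p}`. [folklore] -/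
theorem isCompact_diamond (p q : TwoOriginLine) :
    IsCompact
      (metric.causalFuture timeOrientation {p} ∩ metric.causalPast timeOrientation {q}) := by
  rcases lt_or_ge p.val q.val with hpq | hpq
  · set m : ℝ := (p.val + q.val) / 2 with hm
    have hpm : p.val < m := by rw [hm]; linarith
    have hmq : m < q.val := by rw [hm]; linarith
    have key : metric.causalFuture timeOrientation {p} ∩ metric.causalPast timeOrientation {q} =
        ι p.tag '' Icc p.val m ∪ ι q.tag '' Icc m q.val ∪
          {o | o.val = 0 ∧ p.val < 0 ∧ 0 < q.val} := by
      ext r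
      rw [mem_diamond_iff]
      simp only [mem_union, mem_image, mem_Icc, mem_setOf_eq]
      constructor
      · rintro ⟨h1, h2⟩
        rcases h1 with h1 | h1
        · exact Or.inl (Or.inl ⟨r.val, ⟨h1 ▸ le_rfl, h1 ▸ hpm.le⟩, h1 ▸ ι_tag_val r⟩)
        · rcases h2 with h2 | h2
          · exact Or.inl (Or.inr ⟨r.val, ⟨h2 ▸ hmq.le, h2 ▸ le_rfl⟩, h2 ▸ ι_tag_val r⟩)
          · by_cases hr : r.val = 0
            · exact Or.inr ⟨hr, hr ▸ h1, hr ▸ h2⟩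
            · rcases le_total r.val m with h | h
              · exact Or.inl (Or.inl ⟨r.val, ⟨h1.le, h⟩, (eq_ι_of_val_ne_zero r hr _).symm⟩)
              · exact Or.inl (Or.inr ⟨r.val, ⟨h, h2.le⟩, (eq_ι_of_val_ne_zero r hr _).symm⟩)
      · rintro ((⟨x, ⟨hx1, hx2⟩, rfl⟩ | ⟨x, ⟨hx1, hx2⟩, rfl⟩) | ⟨hr, hp0, hq0⟩)
        · refine ⟨?_, Or.inr (show x < q.val by linarith)⟩
          rcases hx1.eq_or_lt with h | h
          · exact Or.inl (by rw [← h, ι_tag_val])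
          · exact Or.inr h
        · refine ⟨Or.inr (show p.val < x by linarith), ?_⟩
          rcases hx2.eq_or_lt with h | h
          · exact Or.inl (by rw [h, ι_tag_val])
          · exact Or.inr h
        · exact ⟨Or.inr (by rw [hr]; exact hp0), Or.inr (by rw [hr]; exact hq0)⟩
    rw [key]
    refine ((isCompact_Icc.image (continuous_ι _)).union
      (isCompact_Icc.image (continuous_ι _))).union ?_
    exact (finite_setOf_val_eq_zero.subset fun o ho ↦ ho.1).isCompact
  · refine ((Set.finite_singleton p).subset fun r hr ↦ ?_).isCompact
    rw [mem_diamond_iff] at hr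
    obtain ⟨h1 | h1, h2⟩ := hr
    · exact h1
    · exfalso
      rcases h2 with h2 | h2
      · rw [h2] at h1
        exact absurd h1 (not_lt.mpr hpq)
      · linarith

/-! ### `L` is causal with compact diamonds, but not strongly causal -/

/-- **`L` is causal**: it contains no closed causal curves (`val` strictly increases along causal
curves). [folklore] -/
theorem isCausallyWellBehaved : metric.IsCausallyWellBehaved timeOrientation :=
  fun _ _ _ hab hγ h ↦ (val_lt_val hab hγ).ne (congrArg val h)

/-- **`L` is globally hyperbolic in the vendored (Bernal–Sánchez-style) sense**
`LorentzianMetric.IsGloballyHyperbolic`: causal with compact causal diamonds. [folklore] -/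
theorem isGloballyHyperbolic : metric.IsGloballyHyperbolic timeOrientation :=
  ⟨isCausallyWellBehaved, isCompact_diamond⟩

/-- **`L` is not strongly causal** (O'Neill 1983, Ch. 14, p. 437, for the notion): the open
neighbourhood `U = L ∖ {0₂}` of `0₁` contains no neighbourhood `V` of `0₁` which causal curve
segments with endpoints in `V` cannot leave, because the future causal curve `ι true` on
`[-ε/2, ε/2]` has its endpoints `ι(∓ε/2)` in `V` but passes through `0₂ ∉ U`. [folklore] -/
theorem not_isStronglyCausal : ¬ metric.IsStronglyCausal timeOrientation := by
  intro h
  obtain ⟨V, hV, -, hVU⟩ := h (ι false 0) (range (ι false))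
    ((isOpenMap_ι false).isOpen_range.mem_nhds (mem_range_self 0))
  obtain ⟨ε, hε, hball⟩ := Metric.mem_nhds_iff.mp
    ((continuous_ι false).continuousAt.preimage_mem_nhds hV)
  have hmem : ∀ x : ℝ, |x| < ε → x ≠ 0 → ι true x ∈ V := fun x hx hx0 ↦ by
    rw [ι_eq_ι_of_ne_zero hx0 true false]
    exact hball (by rwa [Metric.mem_ball, dist_zero_right, Real.norm_eq_abs])
  have hε2 : |ε / 2| < ε := by
    rw [abs_of_pos (by positivity)]
    linarith
  have hε2' : |-(ε / 2)| < ε := by rwa [abs_neg]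
  obtain ⟨x, hx⟩ := hVU (ι true) (-(ε / 2)) (ε / 2) (by linarith) (isFutureCausalCurveOn_ι true _)
    (hmem _ hε2' (by linarith)) (hmem _ hε2 (by linarith)) 0 ⟨by linarith, by linarith⟩
  have h0 := ι_eq_ι_iff.mp hx
  exact Bool.false_ne_true (h0.2 h0.1)

-- the theorem below must name the deprecated (mis-stated) constant (of `CausalityRefutedFacts`)
set_option linter.deprecated false in
/-- **The vendored fact `LorentzianMetric.IsGloballyHyperbolic.isStronglyCausal` fails for the
line with two origins** with its `C^∞` metric `-dt²` and time orientation `∂ₜ` (`n = ∞ ≥ 2`, the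
manifold is globally hyperbolic in the vendored sense but not strongly causal; unfolded, the
statement reads `¬ (2 ≤ ∞ → metric.IsGloballyHyperbolic timeOrientation →
metric.IsStronglyCausal timeOrientation)`). The positive result for Hausdorff spacetimes is
Bernal–Sánchez 2007, Thm. 3.2 (not vendored). [folklore] -/
theorem not_isGloballyHyperbolic_isStronglyCausal :
    ¬ LorentzianMetric.IsGloballyHyperbolic.isStronglyCausal (g := metric) (τ := timeOrientation) :=
  fun h ↦ not_isStronglyCausal (h ENat.LEInfty.out isGloballyHyperbolic)

/-! ### Two neighbouring vendored facts that fail on `L` -/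

/-- **`J⁺(0₁) = {0₁} ∪ {t > 0}` is not closed in `L`**: the second origin `0₂ ∉ J⁺(0₁)` lies in
its closure (every neighbourhood of `0₂` contains the points `ι true x = ι false x`, `x > 0`
small). In Hausdorff globally hyperbolic spacetimes `J⁺(p)` is closed (O'Neill 1983, Ch. 14,
Lemma 14.22; Bernal–Sánchez 2007, Lemma 3.1). [folklore] -/
theorem not_isClosed_causalFuture_origin :
    ¬ IsClosed (metric.causalFuture timeOrientation {ι false 0}) := by
  intro h
  have h2 : ι true 0 ∈ (metric.causalFuture timeOrientation {ι false 0})ᶜ := by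
    rw [mem_compl_iff, mem_causalFuture_iff]
    rintro (h0 | h0)
    · exact Bool.false_ne_true ((ι_eq_ι_iff.mp h0.symm).2 rfl)
    · simp at h0
  have hev := eventually_ι_mem_of_mem_nhds (h.isOpen_compl.mem_nhds h2) true
  have hev' : ∀ᶠ x in 𝓝[>] (0 : ℝ),
      ι true x ∈ (metric.causalFuture timeOrientation {ι false 0})ᶜ ∧ x ∈ Ioi (0 : ℝ) :=
    (hev.filter_mono (nhdsWithin_mono _ fun x (hx : 0 < x) ↦ hx.ne')).and self_mem_nhdsWithin
  obtain ⟨x, hx, hxpos⟩ := hev'.exists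
  exact hx (mem_causalFuture_iff.mpr (Or.inr hxpos))

-- the theorem below must name the deprecated (mis-stated) constant (of `CausalityRefutedFacts`)
set_option linter.deprecated false in
/-- **The vendored fact `LorentzianMetric.IsGloballyHyperbolic.isClosed_causalFuture` fails for
the line with two origins** (it omits the Hausdorff hypothesis exactly like
`IsGloballyHyperbolic.isStronglyCausal`): `L` is globally hyperbolic in the vendored sense but
`J⁺(0₁)` is not closed (unfolded, the statement reads `¬ (2 ≤ ∞ →
metric.IsGloballyHyperbolic timeOrientation → ∀ p, IsClosed (metric.causalFuture timeOrientation
{p}))`). The positive result for Hausdorff spacetimes is O'Neill 1983, Ch. 14, Lemma 14.22, proved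
in the tree as `LorentzianMetric.IsGloballyHyperbolic.isClosed_causalFuture_singleton`
(`Literature.Geometry.Lorentzian.CausalityProofs`). [folklore] -/
theorem not_isGloballyHyperbolic_isClosed_causalFuture :
    ¬ LorentzianMetric.IsGloballyHyperbolic.isClosed_causalFuture
      (g := metric) (τ := timeOrientation) :=
  fun h ↦ not_isClosed_causalFuture_origin (h ENat.LEInfty.out isGloballyHyperbolic (ι false 0))

-- the theorem below must name the deprecated (mis-stated) constant (of `CausalityRefutedFacts`)
set_option linter.deprecated false in
/-- **The vendored form of Geroch's theorem,
`LorentzianMetric.isGloballyHyperbolic_iff_exists_isCauchySurface`, fails for the line with two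
origins**: `L` is globally hyperbolic in the vendored sense, while the vendored notion
`LorentzianMetric.IsCauchySurface` is uninhabited on every nonempty manifold
(`LorentzianMetric.IsCauchySurface.isEmpty`, the mis-formalised inextendibility recorded in
`Literature.Geometry.Lorentzian.CausalityProofs`). Here the defect is not the Hausdorff hypothesis
but `IsCauchySurface`; `L` merely supplies a globally hyperbolic instance (unfolded, the
statement reads `¬ (2 ≤ ∞ → (metric.IsGloballyHyperbolic timeOrientation ↔ ∃ S,
metric.IsCauchySurface timeOrientation S))`). Geroch 1970, Thm. 11, is the positive result for
spacetimes with the faithful notions. [folklore] -/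
theorem not_isGloballyHyperbolic_iff_exists_isCauchySurface :
    ¬ LorentzianMetric.isGloballyHyperbolic_iff_exists_isCauchySurface metric timeOrientation := by
  intro h
  obtain ⟨S, hS⟩ := (h ENat.LEInfty.out).mp isGloballyHyperbolic
  exact hS.isEmpty.false (ι false 0)

end TwoOriginLine

-- the theorem below must name the deprecated (mis-stated) constant (of `CausalityRefutedFacts`)
set_option linter.deprecated false in
/-- **The universal closure of the vendored fact is false**: it is not the case that every
`C^∞` time-oriented Lorentzian manifold in the generality of
`LorentzianMetric.IsGloballyHyperbolic.isStronglyCausal` (no Hausdorff hypothesis) which is causal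
with compact causal diamonds is strongly causal — the line with two origins is a counterexample
(the last line of the statement unfolds to `2 ≤ ∞ → g.IsGloballyHyperbolic τ →
g.IsStronglyCausal τ`). The statement *with* the Hausdorff (spacetime) hypothesis is
Bernal–Sánchez 2007, Thm. 3.2. [folklore] -/
theorem LorentzianMetric.IsGloballyHyperbolic.not_forall_isStronglyCausal :
    ¬ ∀ (M : Type) [TopologicalSpace M] [ChartedSpace ℝ M] [IsManifold 𝓘(ℝ, ℝ) ∞ M]
        (g : LorentzianMetric 𝓘(ℝ, ℝ) ∞ M) (τ : TimeOrientation g),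
        LorentzianMetric.IsGloballyHyperbolic.isStronglyCausal (g := g) (τ := τ) :=
  fun h ↦ TwoOriginLine.not_isGloballyHyperbolic_isStronglyCausal
    (h TwoOriginLine TwoOriginLine.metric TwoOriginLine.timeOrientation)

end Literature.Geometry.Lorentzian

end
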